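import Mathlib
import HarnessLib
import HarnessLib.Audit
import Summits.AtomisticToContinuum.Statement
import Literature.Barriers.AtomisticToContinuum.TetrahedralFrustration

/-!
Route: BECKeplerCaging

CLOSED (retired) 2026-08-15T13:39:09Z by operator:999:1257524 — reason: not-a-thesis: assembly does not conclude the sub-problem Statement — note: D-0027 §2.1 audit (human 2026-08-15: routes that do not decide the summit are removed): the assembly concludes `NoBecNearClosePacking`, not the sub-problem statement; a NEW conforming route may be opened from the same idea (generated `closes : … → _root_.BoseEinsteinCondensation`).. The file is kept as the record of this route; refuted decls are indexed as negative knowledge (`ledger negatives`).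

# Route BECKeplerCaging — Kepler cages the condensate — no ground-state BEC for hard spheres near
close packing (slack budget, quantum free volume, configuration-space tunnelling)

DELINEATION ROUTE (negative knowledge about the conjunct's parameter range; declared up front: X
does NOT imply
`BoseEinsteinCondensation` and is not claimed to — the Assembly ends in the route Target, as in
routes TaylorResolutionBarrier and
CornerKeplerStability). It suffices to show X = NoBecNearClosePacking (card
kepler-cages-no-bec-near-close-packing): under the tree's
named fact `Hales_kepler`, for hard spheres of diameter a (the admissible potential HS_a = ⊤·1_(r ≤
a), the same term as route
BECHardSphereComparison) there is ε₀ > 0 such that for every density ρ with ρ_cp/(1+ε₀)³ < ρ < ρ_cp,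
ρ_cp = √2/a³ (Kepler), the Dirichlet-box
ground state has NO Bose–Einstein condensation: ¬ HasGroundStateBEC HS_a ρ. Writing ρ = ρ_cp/(1+ε)³,
εa is the mean linear slack per
sphere; the quantitative form proved on the way (UniformCondensateBound) is λ_max(γ) = O_ε(1)
uniformly in N. X certifies that the
conjunct's quantifier "∃ ρ₀(v), ∀ ρ < ρ₀" cannot be widened to "∀ ρ" (today only the vacuous ρ ≥
ρ_cp, where E₀ = ⊤, is excluded) and
hands every density-dial / monotonicity route (BECHardSphereComparison, BECFillingMonotone,
BECDispersionDial, …) a provably BEC-free endpoint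
of the scale-free hard-sphere family ρa³ ∈ (0, √2).
Lean: `Literature.Barriers.AtomisticToContinuum.Hales_kepler → ∀ a : ℝ, 0 < a → ∃ ε₀ : ℝ, 0 < ε₀ ∧ ∀
ρ : ℝ, Real.sqrt 2 / a ^ 3 / (1 + ε₀) ^ 3 < ρ → ρ < Real.sqrt 2 / a ^ 3 → ¬
Literature.MathematicalPhysics.QuantumManyBody.BoseGas.HasGroundStateBEC (Set.indicator (Set.Iic a)
(fun _ : ℝ => (⊤ : ENNReal))) ρ`

## Assembly
Pure logic, sorry-free in Sketch.lean (`assembly_provable : Assembly := fun hA _ _ g₁ g₂ => g₂ (g₁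
hA)`): CagedCoherenceDecay gives
UniformCondensateBound by the Schur glue and the Target by the counting glue. QuantumFreeVolumeLaw
and NearMonodisperseKepler enter the Assembly as
antecedents the glue does not consume: they are the RUNGS of the mechanism (the localisation scale
and the slack budget any proof of crux 2 must
first establish — see Two-layer plan) filed at layer 1 because each is independently attackable by a
different community (many-body analysts;
discrete geometers) and the refutation of either kills crux 2 (Kill criteria). The chain ends in the
route Target NoBecNearClosePacking, deliberately
NOT in Summit.AtomisticToContinuum.BoseEinsteinCondensation (a delineation of the conjunct, neither
S nor ¬S).

Rationale: WHY THIS LINE. Penrose–Onsager's dictum "no BEC in a solid" (PenroseOnsager1956) and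
Prokof'ev–Svistunov's "a commensurate crystal with gapped vacancies and
interstitials is insulating" (ProkofevSvistunov2005; PIMC: ClarkCeperley2006 "We do not find ODLRO
in a perfect hcp crystal", BoninsegniProkofevSvistunov2006
"exponential decay of n(r) … an ideal hcp crystal is not a Bose condensate", CeperleyBernu2004
ring-exchange frequencies lose to their entropy) have
no theorem behind them in the continuum (Chester1970: Jastrow solids DO condense, so the true ground
state is needed; LiebSeiringerSolovejYngvason2005
p. 95: crystalline order of a quantum ground state "has never been proved"). The one regime where
crystallinity need not be proved is the
Kepler corner: at ρ = ρ_cp/(1+ε)³ sphere-packing GEOMETRY cages the particles, and three imported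
tools carry the argument — (i) discrete
geometry: Hales's theorem (HalesDSP2012 Thm 6.9, Flyspeck HalesEtAl2015; tree fact `Hales_kepler`)
gives by a doubling argument that all but
729·(3εN + O(N^(2/3))) spheres are caged (KeplerCagingCount), and its conjectural near-monodisperse
upgrade (no first-order density gain from
radius ratios in (1/(1+t₀), 1]; all densest-known binary packings above ratio 0.660 are
phase-separated Barlow phases, HopkinsStillingerTorquato2011,
arXiv:1111.4917) gives a LINEAR SLACK BUDGET Σ_i min(gap_i, t₀a) ≲ εNa; (ii) many-body Hardy
inequalities (arXiv:math/0608299) turn the slack budget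
into the quantum free-volume law E₀ ≍ N/(εa)² (SalsburgWood1962 / StillingerSalsburg1969
asymptotics, never proved in 3-D even classically);
(iii) semiclassical tunnelling in CONFIGURATION space (Agmon / Helffer–Sjöstrand narrow-passage
decay, HelfferSjostrand1984; hard-sphere
configuration spaces: DiaconisLebeauMichel2010, BaryshnikovBubenikKahle2013, Kahle2012) with a
geometric small parameter: moving a sphere
through an FCC/HCP gate needs a 13.4 % dilation that must be borrowed from ≳ ε^(-1/2) neighbours,
each passage costing e^(-c ε^(-κ)) against ≤ 12ⁿ
gate sequences — a continuum Kirkwood–Thomas / quantum Pirogov–Sinai expansion (KirkwoodThomas1983,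
BorgsKoteckyUeltschi1996,
DattaFernandezFrohlich1996; lattice shadow: the Mott phase of AizenmanEtAl2004) whose classical
reference state is supplied by Kepler, not by an
assumed lattice. Planner's sharpening of the card: shell-SHAPE stability of Kepler (card K1;
Crystallization item StableKeplerCounting) is not
what is needed — SLACK control is (NearMonodisperseKepler), and the per-gate factor is e^(-cε^(-κ))
with κ ∈ [1/2, 3/2] (two-disk channel toy:
e^(-π²√2/√η)), so no statement fixes an exponent. No prior route of this summit touches ρ near ρ_cp,
and the negatives index (1 entry, swap-Jensen) is unrelated.

RANKED CRUXES. #0 NoBecNearClosePacking (target) — under Hales_kepler, for every a > 0 there is ε₀ >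
0 such that for all ρ with √2/a³/(1+ε₀)³ < ρ < √2/a³ the hard-sphere Bose gas has no ground-state
BEC in the Dirichlet box at density ρ (card X_neg = NoBEC_hd). (why it might fail: the ground state
could phase-separate into a compressed crystal plus a dilute superfluid pocket of cN atoms, or carry
gapless zero-point vacancies (Andreev–Lifshitz); heuristics price compression at ε⁻³ per freed atom
vs a gain ε⁻² and PIMC sees neither, but nothing is proved.) [PenroseOnsager1956,
ProkofevSvistunov2005, ClarkCeperley2006, BoninsegniProkofevSvistunov2006, Chester1970,
LiebSeiringerSolovejYngvason2005, HalesDSP2012]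
#2 CagedCoherenceDecay (crux) — (card K3, the engine) under Hales_kepler: for a > 0 there is ε₀ > 0
such that for every ρ in the window there are C and m > 0 with: for all large N and every δ > 0 some
δ-near-minimiser Ψ of the hard-sphere energy in the box of side (N/ρ)^(1/3) has its one-particle
density matrix dominated by an exponential kernel, ⟨φ, γ_Ψ φ⟩ ≤ C ∬ |φ(x)| |φ(y)| e^(−m|x−y|) dx dy
for every normalised mode φ — exponential decay of γ uniformly in N (C ~ ε⁻³ density peaks allowed;
m = m(ε) > 0 not quantified). [deps: QuantumFreeVolumeLaw, KeplerCagingCount] [difficulty: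
open-problem] (why it might fail: the squeeze energy of gate coordinates is the SAME order (εa)⁻² as
the ambient zero-point energy, so smallness must come from a ground-state large deviation over
≳ε^(-1/2) cooperating spheres, uniformly over defective regions; floppy Barlow layer slides (4.9 %
dilation) may drive m(ε) to 0.) [ProkofevSvistunov2005, CeperleyBernu2004,
BoninsegniProkofevSvistunov2006, HelfferSjostrand1984, KirkwoodThomas1983, BorgsKoteckyUeltschi1996,
DattaFernandezFrohlich1996, AizenmanEtAl2004, DiaconisLebeauMichel2010, BaryshnikovBubenikKahle2013]
#3 QuantumFreeVolumeLaw (crux) — (quantum free-volume law, lower half; the scale at which crux 2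
localises) under Hales_kepler: for a > 0 there are ε₁, c > 0 with c INDEPENDENT of ε such that for 0
< ε < ε₁ and all large N, E₀(N, L_N) ≥ c N/(εa)² for hard spheres at ρ = √2/a³/(1+ε)³, L_N =
(N/ρ)^(1/3) (the matching upper bound is support CagedTrialStateEnergy). [deps:
NearMonodisperseKepler] [difficulty: L] (why it might fail: Kepler's counting inequality alone
forces only ~3(C−1)εN spheres to have gap ≤ Cεa, so many-body Hardy yields E₀ ≳ N/(εa²) — one power
short; the ε⁻² law needs most spheres caged at scale εa in energy-typical configurations, i.e. 3-D
free-volume asymptotics never proved even classically.) [SalsburgWood1962, StillingerSalsburg1969,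
KalosLevesqueVerlet1974, arXiv:math/0608299, HalesDSP2012, LiebSeiringerSolovejYngvason2005]
#4 NearMonodisperseKepler (crux) — (slack budget; planner's replacement of card K1) under
Hales_kepler there is t₀ > 0 such that every finite packing of balls with radii in [1/2, (1+t₀)/2]
and centres in a closed cube of side L satisfies Σ_i (2 r_i)³ ≤ √2 (L + 1 + t₀)³ — slightly
polydisperse balls cannot beat Kepler's density to first order (equal radii: the periodisation of
Hales_kepler gives N ≤ √2(L+1)³); inflating each sphere by its capped gap then yields the linear
slack budget Σ_i min(gap_i, t₀a) ≤ C(√2(L+(1+t₀)a)³/a³ − N)·a. [difficulty: open-problem] (why it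
might fail: one periodic packing with radius ratio in (1/(1+t₀), 1] and density > π/√18 refutes it
for that t₀; none is known above small/large ≈ 0.660 (arXiv:1111.4917 §V: densest known are
phase-separated Barlow phases) but nothing is proved, and Flyspeck's inequalities carry no
polydisperse margin.) [HopkinsStillingerTorquato2011, arXiv:1111.4917, HalesDSP2012, HalesEtAl2015,
FejesToth1953]
#9 KeplerCagingCount (support) — (Kepler ⇒ cages, deterministic defect count; card K2 made global)
under Hales_kepler there is C (729 works) such that in every configuration of n points of the closed
cube [0,L]³ with pairwise distances ≥ a, the number of a-UNCAGED points — those that can be moved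
continuously inside the cube, all others fixed and clearances ≥ a kept, to distance ≥ a from their
start — is ≤ C(√2(L+a)³/a³ − n); at ρ = ρ_cp/(1+ε)³ this is ≤ C(3εN + O(N^(2/3))). Proof: each
uncaged point can be doubled (add a ball at the first exit point at distance a), a 4a-separated
subfamily can be doubled simultaneously, and the periodisation of Hales_kepler bounds n + #doubled
by √2(L+a)³/a³. [difficulty: provable-now] [HalesDSP2012, HalesEtAl2015, Kahle2012]
#9 CagedTrialStateEnergy (support) — (finiteness and the free-volume upper bound, card K4) there is
a universal C with E₀(N, L_N) ≤ C N/(εa)² for all large N at ρ = √2/a³/(1+ε)³, 0 < ε < 1: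
symmetrised product of disjoint C¹ bumps of radius < εa/4 centred on a cube-aligned FCC block of
spacing a(1+ε/2) (interaction ≡ 0 on its support; the O(N^(2/3)) boundary sites are absorbed by the
spare slack). [difficulty: provable-now] [LiebSeiringerSolovejYngvason2005, KalosLevesqueVerlet1974]
#9 UniformCondensateBound (support) — (the quantitative no-BEC statement, λ_max(γ) = O(1)) under
Hales_kepler: for a > 0 there is ε₀ > 0 such that for every ρ in the window some K bounds
condensateNumber HS_a N L_N ≤ K for all large N. Follows from CagedCoherenceDecay by
DecayBoundsCondensate; filed because dial routes want exactly this endpoint. [difficulty: L]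
[LiebSeiringerSolovejYngvason2005, PenroseOnsager1956]
#9 DecayBoundsCondensate (support) — (glue, Schur/Young test) CagedCoherenceDecay →
UniformCondensateBound: ∬|φ(x)||φ(y)|e^(−m|x−y|) ≤ ‖φ‖₂² ‖e^(−m|·|)‖₁ = 8π/m³ ‖φ‖₂², so every
near-minimiser of crux 2 has maxOccupation ≤ 8πC/m³, and condensateNumber = sup_δ inf_Ψ
maxOccupation ≤ 8πC/m³ =: K (iInf_maxOccupation_le in tree). [difficulty: provable-now]
[LiebSeiringerSolovejYngvason2005]
#9 BoundExcludesBEC (support) — (glue) UniformCondensateBound → NoBecNearClosePacking: eventually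
ofReal(cN) ≤ condensateNumber ≤ ofReal K forces cN ≤ |K|, absurd for N > |K|/c. PROVED sorry-free in
the planner's Sketch.lean (boundExcludesBEC_provable, 15 lines) — file it verbatim. [difficulty:
provable-now] [LiebSeiringerSolovejYngvason2005]

TWO-LAYER PLAN. Foreseen glued splits (k ≤ 3, depth 1; nothing filed now): QuantumFreeVolumeLaw ⇐
SlackBudget (NearMonodisperseKepler applied to spheres
inflated by their capped gaps: Σ_i min(gap_i, t₀a) ≤ C(√2(L+(1+t₀)a)³/a³ − N)a) → LocalManyBodyHardy
(Σ_i ∫|∇_iΨ|² ≥ c_H ∫ Σ_i Ψ²/gap_i² − C a⁻²∫Ψ²,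
arXiv:math/0608299 localised to the contact zone) → QuantumFreeVolumeLaw (convexity: Σ gap⁻² ≥
n_good³/(Σ gap)²). CagedCoherenceDecay ⇐ CageTypicality
(ground-state large deviation: near-minimisers give weight ≤ e^(−ck) to k simultaneous θ-squeezes,
via the free-volume law and a Feynman–Kac/Doob
transform) → GatePeierls (every admissible path changing a neighbour relation by a crosses a
k(ε)-squeeze, k(ε) → ∞; sum over ≤ 12ⁿ gate words) →
CagedCoherenceDecay. A 2-D hard-disk child (Thue–Fejes Tóth corner, where slack stability IS
classical, FejesToth1953) is the calibration split if
crux 2 stalls; a torus/FCC-commensurate child removes the Dirichlet boundary layer.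

KILL CRITERIA. NearMonodisperseKepler refuted by an explicit denser near-monodisperse packing ⇒ drop
crux 4 and restate the slack budget in TYPICAL (measure) form;
the route survives. QuantumFreeVolumeLaw refuted (E₀ = o(N ε⁻²) along ε → 0, e.g. by a sliding-layer
trial state) ⇒ the caging picture is wrong at its
own scale: close `refuted:QuantumFreeVolumeLaw`. UniformCondensateBound or the Target refuted (a
theorem giving λ_max ≥ cN for hard spheres at some ρ in
every window below ρ_cp — e.g. a rigorous zero-point-vacancy superfluid) ⇒ close
`refuted:NoBecNearClosePacking` and hand the witness to the dial routes
as a positive anchor. CagedCoherenceDecay refuted with the Target still open (γ decays slower than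
exponentially but λ_max = o(N)) ⇒ pivot: restate crux 2
with a summable non-exponential kernel. A proof elsewhere of HasGroundStateBEC HS_a ρ for all ρ <
ρ_cp refutes the route; a proof of the conjunct does
NOT moot it.

NOT DECOMPOSED YET. The gate geometry constants of card K2 (window inradius 0.0774 d, gate ring at
0.866 d, 13.4 % dilation, Barlow slide saddle 4.9 %) and the definition
of "gate passage / neighbour-relation change" for ARBITRARY (non-FCC) configurations; the exponent κ
in m(ε) ~ ε^(−κ) (the toy says κ ≥ 1/2, never
claimed); Hardy constants for sphere complements; the Dirichlet boundary layer and cube–FCC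
commensurability (O(N^(2/3)) bookkeeping inside
CagedTrialStateEnergy); uniqueness / component structure of the hard-sphere ground state (irrelevant
to an UPPER bound on condensateNumber, which only
needs exhibited near-minimisers); the torus and 2-D variants; any use of shell-shape Kepler
stability (Crystallization item StableKeplerCounting) — all
layer-2 children or prover lemmas (`--supports`).

CHEAPEST FALSIFIER. (i) Packing search (kills crux 4 for the tested t₀): run the Torquato–Jiao /
Hopkins–Stillinger–Torquato adaptive-cell search at radius ratio
α ∈ (0.66, 1) for any binary packing with φ > π/√18 = 0.74048; the published sweep (arXiv:1111.4917,
Fig. 2 and §V) found none above α* ≈ 0.660 —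
not re-run here (hub is compute-free; a refuter with kit should). (ii) Toy spectrum (kills the
engine of crux 2 if polynomial): two hard disks of
diameter 1 in a 2-D channel of width 2 + η exchanging places — the symmetric/antisymmetric splitting
of the Dirichlet Laplacian on the two-disk
configuration space must vanish faster than any power of η (planner's adiabatic estimate: neck width
η + s²/2 gives splitting ~ e^(−π²√2/√η)); a
finite-element eigenvalue computation at η = 0.4, 0.2, 0.1, 0.05 decides it in minutes. (iii)
Literature (kills the Target's physics): a PIMC/DMC
measurement of a NON-zero condensate fraction in the commensurate hard-sphere (or hcp ⁴He) crystal
extrapolated to T = 0; the sources read say the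
opposite (ClarkCeperley2006 abstract; BoninsegniProkofevSvistunov2006 p. 2: exponential decay of
n(r) at n = 0.0292 and 0.0359 Å⁻³).

NUMBERS. ρ_cp a³ = √2 = 1.41421 (Kepler, HalesDSP2012 Thm 6.9); hard-sphere bosons solidify near ρa³
≈ 0.23–0.25 (KalosLevesqueVerlet1974, GFMC), i.e. ε ≈ 0.8 —
far outside the claimed window ε < ε₀ (ineffective). FCC/HCP gate: the ring of 4 common neighbours
sits at (√3/2)d = 0.866 d from the gate centre, so a
single sphere passes unaided only if d ≥ (2/√3)a, ε ≥ 0.1547; triangular window inradius (2/√3 −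
1)d/2 = 0.0774 d; a rigid Barlow layer slide needs
interlayer dilation (√3/2 − √(2/3))a = 0.0495 a (caged for ε < 0.06). Packing number in
KeplerCagingCount: 9³ = 729; Kepler deficit at ρ_cp/(1+ε)³:
√2(L+a)³/a³ − N = 3εN + O(ε²N + N^(2/3)). Densest-known binary packings: phase-separated
monodisperse for α > α* ≈ 0.660 (arXiv:1111.4917 §V).
Two-disk channel WKB: ∫ π ds/(η + s²/2) = π²√2/√η. Caged trial state: C = 64π² suffices in
CagedTrialStateEnergy (bump radius εa/4). Items at open: 10
(1 target, 3 cruxes, 5 support, 1 assembly).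

DEFINITION REQUESTS. None needed at open: everything is stated over
Literature.MathematicalPhysics.QuantumManyBody.BoseGas.{TrialState, energy, groundStateEnergy,
occupation, condensateNumber, HasGroundStateBEC, sideLength, Space},
Literature.Barriers.AtomisticToContinuum.Hales_kepler, Set.indicator, Set.Iic,
Nat.card, EuclideanSpace (all `lean search --decl`-ed; Sketch.lean rc 0). Layer 2 will want a
Literature definition of the one-particle density
matrix KERNEL γ_Ψ(x,y) (today only its quadratic form `occupation` exists) and of "a-caged / gate
passage" for configurations; not filed now.
Bib keys added this session (ledger bib add, commit 465d54dc08a6): ProkofevSvistunov2005,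
CeperleyBernu2004, ClarkCeperley2006,
BoninsegniProkofevSvistunov2006, KalosLevesqueVerlet1974, SalsburgWood1962, StillingerSalsburg1969.

Novelty: Searches (2026-08-15): `lit search --hybrid "quantum crystal absence of Bose-Einstein condensation
one-particle density matrix exponential decay"`
(8 held books: LSSY2005 pp. 35/95/114–116, Griffin–Snoke–Stringari 1995, Sethna 2021 … — no theorem;
LSSY p. 95 "crystalline ordering … has never been
proved"); `lit vsearch "ground state of hard sphere bosons at high density near close packing is a
crystal without ODLRO"` (8: Griffin 1995 pp. 24–28 =
Nozieres1995, soft-matter and MC texts); `lit search --source arxiv "densest binary sphere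
packings"` (7: arXiv:1111.4917, 1108.2210, 2010.06813, …; read
1111.4917 pp. 1–22: α* ≈ 0.660); `lit search --source arxiv "off-diagonal long-range order solid
helium"` (4: cond-mat/0512103 read pp. 1–2, cond-mat/0501441,
physics/0605225); `lit read arxiv:cond-mat/0512547` pp. 1–3; `lit search --source arxiv
"many-particle Hardy inequalities"` (5: math/0608299, 1101.2653 …);
`lit galaxy search "supersolid" --star all` (25 rows, physics theses/PRB only, no rigorous item) and
`"off-diagonal long-range order in solid" --star all`
(0); `lit galaxy search "binary sphere packing" --star pdf` (4: Torquato hyperuniformity review,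
arXiv:1704.08156); tree grep of all 43 Theses of the sub
for kepler|close packing|cage (incidental only) and of `Hales_kepler` consumers (Crystallization
routes RadialAperiodicTwin, LinkCensus,
CornerKeplerStability); `ledger idea list` (57 routed cards of the sub, none at high density);
OpenAlex/S2 rate-limited (HTTP 429) this  [refs: 1111.4917, cond-mat/0512547, 1704.08156, arxiv:cond-mat/0512547, LSSY2005, Nozieres1995, ProkofevSvistunov2005, ClarkCeperley2006, BoninsegniProkofevSvistunov2006, CeperleyBernu2004, Chester1970, AizenmanEtAl2004, BorgsKoteckyUeltschi1996, DattaFernandezFrohlich1996, HalesDSP2012, HalesEtAl2015, HopkinsStillingerTorquato2011, SalsburgWood1962, StillingerSalsburg1969]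

Barriers (technique_class: configuration-space-tunnelling, packing-stability): - technique_class: configuration-space-tunnelling, packing-stability
- Literature.Barriers.AtomisticToContinuum.EnergyAsymptoticsWithoutCondensation: evaded — no energy
asymptotics are matched to a condensate; energies enter only as the localisation SCALE
(QuantumFreeVolumeLaw, two-sided up to constants), the conclusion is an eigenfunction (γ-kernel)
bound.
- Literature.Barriers.AtomisticToContinuum.KineticGapLengthScales: not applicable — no condensation
is derived; the only "gap" is the transverse squeeze (εa)⁻² of caged coordinates, uniform in L, and
crux 2's why-might-fail concedes it is the same order as the ambient energy (smallness comes from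
multiplicity, not from a gap).
- Literature.Barriers.AtomisticToContinuum.KissingTwelveDegeneracy: applies to the card's K1 and is
SIDESTEPPED by the planner's sharpening — no statement asks which 12-shell or which stacking occurs;
NearMonodisperseKepler and KeplerCagingCount are counting/volume statements blind to
FCC-vs-HCP-vs-icosahedral shells.
- Literature.Barriers.AtomisticToContinuum.FlexibleKissingArrangements: same — shell rigidity is
never used; the honest residue is crux 2's uniformity over the ≤ C·3εN uncaged/defective spheres,
handled by the GLOBAL slack budget rather than local rigidity.
- Literature.Barriers.AtomisticToContinuum.TetrahedralFrustration: respected — Kepler is consumed as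
the vendored named fact Hales_kepler (hybrid Marchal-cell proof), never re-proved by a single-cell
local density inequality; crux 4

History (route lifecycle, newest last):
- 2026-08-15T13:39:09Z · CLOSED retired — not-a-thesis: assembly does not conclude the sub-problem Statement (operator:999:1257524)

sub-problem: BoseEinsteinCondensation · status: closed(retired) · opened planner-plancard-AtomisticToContinuum-BoseEin-c7a904c3-0 2026-08-15T12:50:08Z · rev 0 · ledger route-AtomisticToContinuum-BECKeplerCaging
GENERATED by the gate from the ledger (D-0016/17). Provers cite these decls: `theorem foo : Summit.AtomisticToContinuum.BoseEinsteinCondensation.Theses.BECKeplerCaging.<Decl> := …` in Summits/AtomisticToContinuum/BoseEinsteinCondensation/Theorems/<Name>.lean.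
-/

namespace Summit.AtomisticToContinuum.BoseEinsteinCondensation.Theses.BECKeplerCaging

open scoped BigOperators Topology Manifold Classical MeasureTheory ProbabilityTheory Matrix InnerProductSpace ComplexConjugate ContinuousMap
open Filter Set Function TopologicalSpace MeasureTheory

attribute [summit_statement] _root_.BoseEinsteinCondensation

/-- item stmt-AtomisticToContinuum-8441 · target · rank 0 · closed · moot by None · by planner
why it might fail: the ground state could phase-separate into a compressed crystal plus a dilute superfluid pocket of cN atoms, or carry gapless zero-point vacancies (Andreev–Lifshitz); heuristics price compression at ε⁻³ per freed atom vs a gain ε⁻² and PIMC sees neither, but nothing is proved.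
sources: PenroseOnsager1956, ProkofevSvistunov2005, ClarkCeperley2006, BoninsegniProkofevSvistunov2006, Chester1970, LiebSeiringerSolovejYngvason2005
[target] under Hales_kepler, for every a > 0 there is ε₀ > 0 such that for all ρ with √2/a³/(1+ε₀)³
< ρ < √2/a³ the hard-sphere Bose gas has no ground-state BEC in the Dirichlet box at density ρ (card
X_neg = NoBEC_hd). -/
@[route_item "route-AtomisticToContinuum-BECKeplerCaging"]
def NoBecNearClosePacking : Prop :=
  Literature.Barriers.AtomisticToContinuum.Hales_kepler → ∀ a : ℝ, 0 < a → ∃ ε₀ : ℝ, 0 < ε₀ ∧ ∀ ρ : ℝ, Real.sqrt 2 / a ^ 3 / (1 + ε₀) ^ 3 < ρ → ρ < Real.sqrt 2 / a ^ 3 → ¬ Literature.MathematicalPhysics.QuantumManyBody.BoseGas.HasGroundStateBEC (Set.indicator (Set.Iic a) (fun _ : ℝ => (⊤ : ENNReal))) ρ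

/-- item stmt-AtomisticToContinuum-8442 · crux · rank 2 · closed · moot by None · by planner
why it might fail: the squeeze energy of gate coordinates is the SAME order (εa)⁻² as the ambient zero-point energy, so smallness must come from a ground-state large deviation over ≳ε^(-1/2) cooperating spheres, uniformly over defective regions; floppy Barlow layer slides (4.9 % dilation) may drive m(ε) to 0.
sources: ProkofevSvistunov2005, CeperleyBernu2004, BoninsegniProkofevSvistunov2006, HelfferSjostrand1984, KirkwoodThomas1983, BorgsKoteckyUeltschi1996
[crux] (card K3, the engine) under Hales_kepler: for a > 0 there is ε₀ > 0 such that for every ρ in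
the window there are C and m > 0 with: for all large N and every δ > 0 some δ-near-minimiser Ψ of
the hard-sphere energy in the box of side (N/ρ)^(1/3) has its one-particle density matrix dominated
by an exponential kernel, ⟨φ, γ_Ψ φ⟩ ≤ C ∬ |φ(x)| |φ(y)| e^(−m|x−y|) dx dy for every normalised mode
φ — exponential decay of γ uniformly in N (C ~ ε⁻³ density peaks allowed; m = m(ε) > 0 not
quantified). [deps: QuantumFreeVolumeLaw, KeplerCagingCount] [difficulty: open-problem] -/
@[route_item "route-AtomisticToContinuum-BECKeplerCaging"]
def CagedCoherenceDecay : Prop :=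
  Literature.Barriers.AtomisticToContinuum.Hales_kepler → ∀ a : ℝ, 0 < a → ∃ ε₀ : ℝ, 0 < ε₀ ∧ ∀ ρ : ℝ, Real.sqrt 2 / a ^ 3 / (1 + ε₀) ^ 3 < ρ → ρ < Real.sqrt 2 / a ^ 3 → ∃ C m : ℝ, 0 < m ∧ ∀ᶠ N : ℕ in Filter.atTop, ∀ δ : ENNReal, 0 < δ → ∃ Ψ : Literature.MathematicalPhysics.QuantumManyBody.BoseGas.TrialState N (Literature.MathematicalPhysics.QuantumManyBody.BoseGas.sideLength ρ N), Literature.MathematicalPhysics.QuantumManyBody.BoseGas.energy (Set.indicator (Set.Iic a) (fun _ : ℝ => (⊤ : ENNReal))) Ψ ≤ Literature.MathematicalPhysics.QuantumManyBody.BoseGas.groundStateEnergy (Set.indicator (Set.Iic a) (fun _ : ℝ => (⊤ : ENNReal))) N (Literature.MathematicalPhysics.QuantumManyBody.BoseGas.sideLength ρ N) + δ ∧ ∀ φ : Literature.MathematicalPhysics.QuantumManyBody.BoseGas.Space → ℂ, MeasureTheory.AEStronglyMeasurable φ MeasureTheory.volume → ∫⁻ x, (‖φ x‖₊ : ENNReal)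 ^ 2 = 1 → Literature.MathematicalPhysics.QuantumManyBody.BoseGas.occupation N φ Ψ.ψ ≤ ENNReal.ofReal C * ∫⁻ x, ∫⁻ y, (‖φ x‖₊ : ENNReal) * (‖φ y‖₊ : ENNReal) * ENNReal.ofReal (Real.exp (-(m * dist x y)))

/-- item stmt-AtomisticToContinuum-8443 · crux · rank 3 · closed · moot by None · by planner
why it might fail: Kepler's counting inequality alone forces only ~3(C−1)εN spheres to have gap ≤ Cεa, so many-body Hardy yields E₀ ≳ N/(εa²) — one power short; the ε⁻² law needs most spheres caged at scale εa in energy-typical configurations, i.e. 3-D free-volume asymptotics never proved even classically.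
sources: SalsburgWood1962, StillingerSalsburg1969, KalosLevesqueVerlet1974, arXiv:math/0608299, HalesDSP2012, LiebSeiringerSolovejYngvason2005
[crux] (quantum free-volume law, lower half; the scale at which crux 2 localises) under
Hales_kepler: for a > 0 there are ε₁, c > 0 with c INDEPENDENT of ε such that for 0 < ε < ε₁ and all
large N, E₀(N, L_N) ≥ c N/(εa)² for hard spheres at ρ = √2/a³/(1+ε)³, L_N = (N/ρ)^(1/3) (the
matching upper bound is support CagedTrialStateEnergy). [deps: NearMonodisperseKepler] [difficulty:
L] -/
@[route_item "route-AtomisticToContinuum-BECKeplerCaging"]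
def QuantumFreeVolumeLaw : Prop :=
  Literature.Barriers.AtomisticToContinuum.Hales_kepler → ∀ a : ℝ, 0 < a → ∃ ε₁ c : ℝ, 0 < ε₁ ∧ 0 < c ∧ ∀ ε : ℝ, 0 < ε → ε < ε₁ → ∀ᶠ N : ℕ in Filter.atTop, ENNReal.ofReal (c * (N : ℝ) / (ε * a) ^ 2) ≤ Literature.MathematicalPhysics.QuantumManyBody.BoseGas.groundStateEnergy (Set.indicator (Set.Iic a) (fun _ : ℝ => (⊤ : ENNReal))) N (Literature.MathematicalPhysics.QuantumManyBody.BoseGas.sideLength (Real.sqrt 2 / a ^ 3 / (1 + ε) ^ 3) N)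

/-- item stmt-AtomisticToContinuum-8444 · crux · rank 4 · closed · moot by None · by planner
why it might fail: one periodic packing with radius ratio in (1/(1+t₀), 1] and density > π/√18 refutes it for that t₀; none is known above small/large ≈ 0.660 (arXiv:1111.4917 §V: densest known are phase-separated Barlow phases) but nothing is proved, and Flyspeck's inequalities carry no polydisperse margin.
sources: HopkinsStillingerTorquato2011, arXiv:1111.4917, HalesDSP2012, HalesEtAl2015, FejesToth1953
[crux] (slack budget; planner's replacement of card K1) under Hales_kepler there is t₀ > 0 such that
every finite packing of balls with radii in [1/2, (1+t₀)/2] and centres in a closed cube of side L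
satisfies Σ_i (2 r_i)³ ≤ √2 (L + 1 + t₀)³ — slightly polydisperse balls cannot beat Kepler's density
to first order (equal radii: the periodisation of Hales_kepler gives N ≤ √2(L+1)³); inflating each
sphere by its capped gap then yields the linear slack budget Σ_i min(gap_i, t₀a) ≤
C(√2(L+(1+t₀)a)³/a³ − N)·a. [difficulty: open-problem] -/
@[route_item "route-AtomisticToContinuum-BECKeplerCaging"]
def NearMonodisperseKepler : Prop :=
  Literature.Barriers.AtomisticToContinuum.Hales_kepler → ∃ t₀ : ℝ, 0 < t₀ ∧ ∀ (n : ℕ) (L : ℝ) (x : Fin n → EuclideanSpace ℝ (Fin 3)) (r : Fin n → ℝ), 0 < L → (∀ i k, x i k ∈ Set.Icc 0 L) → (∀ i, 1 / 2 ≤ r i ∧ r i ≤ (1 + t₀) / 2) → (∀ i j, i ≠ j → r i + r j ≤ dist (x i) (x j)) → ∑ i, (2 * r i) ^ 3 ≤ Real.sqrt 2 * (L + 1 + t₀) ^ 3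

/-- item stmt-AtomisticToContinuum-8445 · support · rank 9 · closed · moot by None · by planner
sources: HalesDSP2012, HalesEtAl2015, Kahle2012
[support] (Kepler ⇒ cages, deterministic defect count; card K2 made global) under Hales_kepler there
is C (729 works) such that in every configuration of n points of the closed cube [0,L]³ with
pairwise distances ≥ a, the number of a-UNCAGED points — those that can be moved continuously inside
the cube, all others fixed and clearances ≥ a kept, to distance ≥ a from their start — is ≤
C(√2(L+a)³/a³ − n); at ρ = ρ_cp/(1+ε)³ this is ≤ C(3εN + O(N^(2/3))). Proof: each uncaged point can
be doubled (add a ball at the first exit point at distance a), a 4a-separated subfamily can be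
doubled simultaneously, and the periodisation of Hales_kepler bounds n + #doubled by √2(L+a)³/a³.
[difficulty: provable-now] -/
@[route_item "route-AtomisticToContinuum-BECKeplerCaging"]
def KeplerCagingCount : Prop :=
  Literature.Barriers.AtomisticToContinuum.Hales_kepler → ∃ C : ℝ, ∀ (n : ℕ) (a L : ℝ) (x : Fin n → EuclideanSpace ℝ (Fin 3)), 0 < a → 0 < L → (∀ i k, x i k ∈ Set.Icc 0 L) → (∀ i j, i ≠ j → a ≤ dist (x i) (x j)) → (Nat.card {i : Fin n // ∃ γ : ℝ → EuclideanSpace ℝ (Fin 3), ContinuousOn γ (Set.Icc 0 1) ∧ γ 0 = x i ∧ (∀ t ∈ Set.Icc (0 : ℝ) 1, (∀ k, γ t k ∈ Set.Icc 0 L) ∧ ∀ j, j ≠ i → a ≤ dist (γ t) (x j)) ∧ a ≤ dist (γ 1) (x i)} : ℝ) ≤ C * (Real.sqrt 2 * (L + a) ^ 3 / a ^ 3 - n)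

/-- item stmt-AtomisticToContinuum-8446 · support · rank 9 · closed · moot by None · by planner
sources: LiebSeiringerSolovejYngvason2005, KalosLevesqueVerlet1974
[support] (finiteness and the free-volume upper bound, card K4) there is a universal C with E₀(N,
L_N) ≤ C N/(εa)² for all large N at ρ = √2/a³/(1+ε)³, 0 < ε < 1: symmetrised product of disjoint C¹
bumps of radius < εa/4 centred on a cube-aligned FCC block of spacing a(1+ε/2) (interaction ≡ 0 on
its support; the O(N^(2/3)) boundary sites are absorbed by the spare slack). [difficulty:
provable-now] -/
@[route_item "route-AtomisticToContinuum-BECKeplerCaging"]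
def CagedTrialStateEnergy : Prop :=
  ∃ C : ℝ, ∀ a : ℝ, 0 < a → ∀ ε : ℝ, 0 < ε → ε < 1 → ∀ᶠ N : ℕ in Filter.atTop, Literature.MathematicalPhysics.QuantumManyBody.BoseGas.groundStateEnergy (Set.indicator (Set.Iic a) (fun _ : ℝ => (⊤ : ENNReal))) N (Literature.MathematicalPhysics.QuantumManyBody.BoseGas.sideLength (Real.sqrt 2 / a ^ 3 / (1 + ε) ^ 3) N) ≤ ENNReal.ofReal (C * (N : ℝ) / (ε * a) ^ 2)

/-- item stmt-AtomisticToContinuum-8447 · support · rank 9 · closed · moot by None · by planner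
sources: LiebSeiringerSolovejYngvason2005, PenroseOnsager1956
[support] (the quantitative no-BEC statement, λ_max(γ) = O(1)) under Hales_kepler: for a > 0 there
is ε₀ > 0 such that for every ρ in the window some K bounds condensateNumber HS_a N L_N ≤ K for all
large N. Follows from CagedCoherenceDecay by DecayBoundsCondensate; filed because dial routes want
exactly this endpoint. [difficulty: L] -/
@[route_item "route-AtomisticToContinuum-BECKeplerCaging"]
def UniformCondensateBound : Prop :=
  Literature.Barriers.AtomisticToContinuum.Hales_kepler → ∀ a : ℝ, 0 < a → ∃ ε₀ : ℝ, 0 < ε₀ ∧ ∀ ρ : ℝ, Real.sqrt 2 / a ^ 3 / (1 + ε₀) ^ 3 < ρ → ρ < Real.sqrt 2 / a ^ 3 → ∃ K : ℝ, ∀ᶠ N : ℕ in Filter.atTop, Literature.MathematicalPhysics.QuantumManyBody.BoseGas.condensateNumber (Set.indicator (Set.Iic a) (fun _ : ℝ => (⊤ : ENNReal))) N (Literature.MathematicalPhysics.QuantumManyBody.BoseGas.sideLength ρ N) ≤ ENNReal.ofReal K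

/-- item stmt-AtomisticToContinuum-8448 · support · rank 9 · closed · moot by None · by planner
sources: LiebSeiringerSolovejYngvason2005
[support] (glue, Schur/Young test) CagedCoherenceDecay → UniformCondensateBound:
∬|φ(x)||φ(y)|e^(−m|x−y|) ≤ ‖φ‖₂² ‖e^(−m|·|)‖₁ = 8π/m³ ‖φ‖₂², so every near-minimiser of crux 2 has
maxOccupation ≤ 8πC/m³, and condensateNumber = sup_δ inf_Ψ maxOccupation ≤ 8πC/m³ =: K
(iInf_maxOccupation_le in tree). [difficulty: provable-now] -/
@[route_item "route-AtomisticToContinuum-BECKeplerCaging"]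
def DecayBoundsCondensate : Prop :=
  CagedCoherenceDecay → UniformCondensateBound

/-- item stmt-AtomisticToContinuum-8449 · support · rank 9 · closed · moot by None · by planner
sources: LiebSeiringerSolovejYngvason2005
[support] (glue) UniformCondensateBound → NoBecNearClosePacking: eventually ofReal(cN) ≤
condensateNumber ≤ ofReal K forces cN ≤ |K|, absurd for N > |K|/c. PROVED sorry-free in the
planner's Sketch.lean (boundExcludesBEC_provable, 15 lines) — file it verbatim. [difficulty:
provable-now] -/
@[route_item "route-AtomisticToContinuum-BECKeplerCaging"]
def BoundExcludesBEC : Prop :=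
  UniformCondensateBound → NoBecNearClosePacking

/-- item stmt-AtomisticToContinuum-8450 · assembly · rank 1 · closed · moot by None · by planner
sources: LiebSeiringerSolovejYngvason2005, HalesDSP2012, ProkofevSvistunov2005
[assembly] CagedCoherenceDecay → QuantumFreeVolumeLaw → NearMonodisperseKepler →
DecayBoundsCondensate → BoundExcludesBEC → NoBecNearClosePacking. -/
@[route_item "route-AtomisticToContinuum-BECKeplerCaging"]
def Assembly : Prop :=
  CagedCoherenceDecay → QuantumFreeVolumeLaw → NearMonodisperseKepler → DecayBoundsCondensate → BoundExcludesBEC → NoBecNearClosePacking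

end Summit.AtomisticToContinuum.BoseEinsteinCondensation.Theses.BECKeplerCaging
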